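import Summits.QuantumFields.QCD.Theses.EulerDescent
import Summits.QuantumFields.QCD.Theorems.QuarksAsStableActionStableActionBridgeDefs
import Summits.QuantumFields.QCD.Theorems.EulerDescentRetypedContinuumComplementHeavyCalibrationOrderedBinomial
import Literature.MathematicalPhysics.QuantumFieldTheory.QCDCalibratedSpecies
import HarnessLib

/-!
# The scheme-transfer identity of the lattice QCD `n`-point functions
(helper of stub `stub_heavyCalibration`, line `vitali-mass-descent`, crux
`Summit.QuantumFields.QCD.Theses.EulerDescent.RetypedContinuumComplement`, item stmt-QuantumFields-16903)

Two schemes over the SAME regularisation, mass tuple and step — `reg.scheme m z₁ shift₁` (reference,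
`z₁ ≠ 0` on the species used) and `reg.scheme m z₂ shift₂` (target) — share the torus, the coupling,
the bare masses and the honest functional; their smeared fields differ by an affine change
`Φ₂^s(g) = λ_s Φ₁^s(g) + c_s(g)·1`, `λ_s = z₂(s,k)/z₁(s,k)`,
`c_s(g) = z₂ a_k⁴ (shift₁ − shift₂)(s,k) Σ_{x ∈ box} g(a_k x)` (`smeared_transfer`).  Expanding the ORDERED
product of the target fields (`prod_ofFn_add_algebraMap` of `…HeavyCalibrationOrderedBinomial`) and
using the linearity of the Berezin and Bochner integrals gives the RAW TRANSFER IDENTITY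
(`qcdLatticeSchwinger_transfer`): the target `n`-point function is the sum over subsets `B ⊆ Fin n` of
`(∏_{i ∉ B} c_{σᵢ}(fᵢ)) (∏_{i ∈ B} λ_{σᵢ})` times the reference `|B|`-point function of the sub-string
`(σ, f) ∘ e_B`.  If the target scheme is ONE-POINT SUBTRACTED on the string (every `⟨Φ₂^{σᵢ}(fᵢ)⟩ = 0`,
as for every `CalibratedSpeciesFamily`), the constants are `c_{σᵢ}(fᵢ)·(Z/Z) = −λ_{σᵢ} ⟨Φ₁^{σᵢ}(fᵢ)⟩`
(`onePoint_transfer`) and the identity becomes the TRUNCATION BY ONE-POINT FUNCTIONS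
(`qcdLatticeSchwinger_transfer_of_onePoint_eq_zero`, `calibrated_transfer`):

  `S₂(σ, f) = (∏ᵢ λ_{σᵢ}) · Σ_B (−1)^{|Bᶜ|} (∏_{i ∉ B} ⟨Φ₁^{σᵢ}(fᵢ)⟩) · S₁(σ ∘ e_B, f ∘ e_B)`,

i.e. the calibrated field is EXACTLY `λ_s (Φ₁^s − ⟨Φ₁^s⟩)` inside every correlation function — the
wave-function plus vacuum-expectation renormalisation of composite fields (Montvay–Münster 1994 §1.7,
§5.1; truncation: Glimm–Jaffe 1987 §6.1).  `tendsto_calibrated_of_tendsto` is the resulting CONVERGENCE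
TRANSFER: convergent ratios `λ` and convergent reference functions at all sub-strings give convergent
calibrated functions.  Supporting lemmas: coefficient regularity / integrability of the smeared products,
`S · (Z/Z) = S` (`qcdLatticeSchwinger_mul_zeroPoint`), arity transport along `B.card = n'`.
Everything is proved; def-free theorem file.
-/

noncomputable section

namespace Summit.QuantumFields.QCD.Cruxes.RetypedContinuumComplement.VitaliMassDescent

open scoped BigOperators SchwartzMap
open MeasureTheory Filter
open Literature.MathematicalPhysics.AQFT Literature.Probability.LatticeModels
  Literature.MathematicalPhysics.QuantumLattice Literature.MathematicalPhysics.QuantumFieldTheory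
open Literature.MathematicalPhysics.QuantumLattice.GrassmannAlgebra
open Summit.QuantumFields.QCD.Cruxes.StableActionBridge.Sketch

variable {Nf : ℕ}

/-! ### Pointwise transfer of the smeared fields, regularity -/

/-- **Affine transfer of the smeared field.**  Over the scheme `sch` (with `z_s(k) ≠ 0`), the smeared
field of species `s` with renormalisations `(z₂, shift₂)` and everything else unchanged is
`Φ₂^s(g) = (z₂/z)·Φ^s(g) + z₂ a_k⁴ (shift − shift₂) (Σ_x g(a_k x)) · 1`. [cite: MontvayMunster1994, §5.1] -/
theorem smeared_transfer (sch : QCDScheme Nf) (k : ℕ) (z₂ shift₂ : QCDField Nf → ℕ → ℝ)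
    (s : QCDField Nf) (hz : sch.z s k ≠ 0) (g : 𝓢(EuclideanSpace ℝ (Fin 4), ℝ))
    (U : GaugeConfig 4 (sch.side k) (Matrix.specialUnitaryGroup (Fin 3) ℂ)) :
    (∑ x ∈ box 4 (sch.L k), ((z₂ s k * sch.a k ^ 4 * g (sch.a k • siteToE x) : ℝ) : ℂ) •
        (insertion U s x - algebraMap ℂ _ ((shift₂ s k : ℝ) : ℂ))) =
      ((z₂ s k / sch.z s k : ℝ) : ℂ) • smearedInsertion sch k U s g +
        algebraMap ℂ _ (((z₂ s k * sch.a k ^ 4 * (sch.shift s k - shift₂ s k) : ℝ) : ℂ) *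
          ∑ x ∈ box 4 (sch.L k), ((g (sch.a k • siteToE x) : ℝ) : ℂ)) := by
  have hz' : ((sch.z s k : ℝ) : ℂ) ≠ 0 := Complex.ofReal_ne_zero.2 hz
  simp only [smearedInsertion]
  rw [Finset.mul_sum, map_sum, Finset.smul_sum, ← Finset.sum_add_distrib]
  refine Finset.sum_congr rfl fun x _ => ?_
  rw [Algebra.algebraMap_eq_smul_one, Algebra.algebraMap_eq_smul_one, Algebra.algebraMap_eq_smul_one,
    smul_sub, smul_sub, smul_smul, smul_sub, smul_smul, smul_smul]
  match_scalars
  · field_simp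
  · field_simp
    ring

/-- The smeared field is coefficient-regular in the gauge field (finite sum of the regular centred
insertions `renormInsertion`). [folklore] -/
theorem coeffRegular_smearedInsertion (sch : QCDScheme Nf) (k : ℕ) (s : QCDField Nf)
    (g : 𝓢(EuclideanSpace ℝ (Fin 4), ℝ)) :
    CoeffRegular (fun U : GaugeConfig 4 (sch.side k) (Matrix.specialUnitaryGroup (Fin 3) ℂ) =>
      smearedInsertion sch k U s g) := by
  have he : (fun U : GaugeConfig 4 (sch.side k) (Matrix.specialUnitaryGroup (Fin 3) ℂ) =>
      smearedInsertion sch k U s g) = fun U => ∑ y ∈ box 4 (sch.L k),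
        ((g (sch.a k • siteToE y) : ℝ) : ℂ) • renormInsertion sch k s y U :=
    funext fun U => smearedInsertion_eq_sum_smul_renormInsertion sch k U s g
  rw [he]
  exact CoeffRegular.sum (box 4 (sch.L k)) fun y _ => (coeffRegular_renormInsertion sch k s y).const_smul _

/-- **Integrability of the numerator integrand of `qcdLatticeSchwinger`**: the Berezin integral of the
ordered product of smeared fields against the fermionic Boltzmann factor is integrable for the Wilson
gauge measure (bounded and measurable on a probability space). [folklore] -/
theorem integrable_fermiIntegral_prod_smearedInsertion (sch : QCDScheme Nf) (k : ℕ) {n : ℕ}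
    (σ : Fin n → QCDField Nf) (f : Fin n → 𝓢(EuclideanSpace ℝ (Fin 4), ℝ)) :
    Integrable (fun U : GaugeConfig 4 (sch.side k) (Matrix.specialUnitaryGroup (Fin 3) ℂ) =>
      fermiIntegral ((List.ofFn fun i => smearedInsertion sch k U (σ i) (f i)).prod *
        fermiBoltzmann U fun fl => sch.mq fl k)) (qcdGaugeMeasure sch k) := by
  haveI : IsProbabilityMeasure (qcdGaugeMeasure sch k) := isProbabilityMeasure_wilsonMeasure_fundamental _
  exact Summit.QuantumFields.QCD.Cruxes.ChiralDescent.InfimumDescent.integrable_apply_of_coeffRegular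
    ((coeffRegular_prod_ofFn fun i => coeffRegular_smearedInsertion sch k (σ i) (f i)).mul
      (coeffRegular_qcdBoltzmann fun fl => sch.mq fl k)) fermiIntegral _

/-! ### The raw transfer identity -/

/-- **Expansion of the ordered product of the transferred fields**: with `λᵢ = z₂/z` and the central
constants `cᵢ` of `smeared_transfer`,
`∏ᵢ Φ₂^{σᵢ}(fᵢ) = Σ_B (∏_{i ∉ B} cᵢ)(∏_{i ∈ B} λᵢ) • ∏_{j} Φ^{σ(e_B j)}(f(e_B j))` (ordered). [folklore] -/
theorem prod_smeared_transfer (sch : QCDScheme Nf) (k : ℕ) (z₂ shift₂ : QCDField Nf → ℕ → ℝ)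
    {n : ℕ} (σ : Fin n → QCDField Nf) (hz : ∀ i, sch.z (σ i) k ≠ 0)
    (f : Fin n → 𝓢(EuclideanSpace ℝ (Fin 4), ℝ))
    (U : GaugeConfig 4 (sch.side k) (Matrix.specialUnitaryGroup (Fin 3) ℂ)) :
    (List.ofFn fun i => ∑ x ∈ box 4 (sch.L k),
        ((z₂ (σ i) k * sch.a k ^ 4 * f i (sch.a k • siteToE x) : ℝ) : ℂ) •
          (insertion U (σ i) x - algebraMap ℂ _ ((shift₂ (σ i) k : ℝ) : ℂ))).prod =
      ∑ B : Finset (Fin n),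
        ((∏ i ∈ Bᶜ, (((z₂ (σ i) k * sch.a k ^ 4 * (sch.shift (σ i) k - shift₂ (σ i) k) : ℝ) : ℂ) *
            ∑ x ∈ box 4 (sch.L k), ((f i (sch.a k • siteToE x) : ℝ) : ℂ))) *
          ∏ i ∈ B, ((z₂ (σ i) k / sch.z (σ i) k : ℝ) : ℂ)) •
        (List.ofFn fun j : Fin B.card =>
          smearedInsertion sch k U (σ (B.orderEmbOfFin rfl j)) (f (B.orderEmbOfFin rfl j))).prod := by
  have hfun : (fun i => ∑ x ∈ box 4 (sch.L k),
      ((z₂ (σ i) k * sch.a k ^ 4 * f i (sch.a k • siteToE x) : ℝ) : ℂ) •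
        (insertion U (σ i) x - algebraMap ℂ _ ((shift₂ (σ i) k : ℝ) : ℂ))) =
      fun i => ((z₂ (σ i) k / sch.z (σ i) k : ℝ) : ℂ) • smearedInsertion sch k U (σ i) (f i) +
        algebraMap ℂ _ (((z₂ (σ i) k * sch.a k ^ 4 * (sch.shift (σ i) k - shift₂ (σ i) k) : ℝ) : ℂ) *
          ∑ x ∈ box 4 (sch.L k), ((f i (sch.a k • siteToE x) : ℝ) : ℂ)) :=
    funext fun i => smeared_transfer sch k z₂ shift₂ (σ i) (hz i) (f i) U
  rw [hfun, prod_ofFn_add_algebraMap]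
  refine Finset.sum_congr rfl fun B _ => ?_
  rw [prod_ofFn_smul, smul_smul, prod_orderEmbOfFin B fun i => ((z₂ (σ i) k / sch.z (σ i) k : ℝ) : ℂ)]

/-- **Raw transfer identity over a scheme** (the honest expectation of the transferred product): by
linearity of the Berezin integral and of the Bochner integral (integrable terms) and the common
denominator, the `n`-point function of the fields with renormalisations `(z₂, shift₂)` is
`Σ_B (∏_{i ∉ B} cᵢ)(∏_{i ∈ B} λᵢ) · S(σ ∘ e_B, f ∘ e_B)` in the functions `S` of `sch`. [cite: GlimmJaffe1987, §6.1] -/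
theorem schwinger_transfer_raw (sch : QCDScheme Nf) (k : ℕ) (z₂ shift₂ : QCDField Nf → ℕ → ℝ)
    {n : ℕ} (σ : Fin n → QCDField Nf) (hz : ∀ i, sch.z (σ i) k ≠ 0)
    (f : Fin n → 𝓢(EuclideanSpace ℝ (Fin 4), ℝ)) :
    (∫ U, fermiIntegral ((List.ofFn fun i => ∑ x ∈ box 4 (sch.L k),
        ((z₂ (σ i) k * sch.a k ^ 4 * f i (sch.a k • siteToE x) : ℝ) : ℂ) •
          (insertion U (σ i) x - algebraMap ℂ _ ((shift₂ (σ i) k : ℝ) : ℂ))).prod *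
        fermiBoltzmann U fun fl => sch.mq fl k) ∂(qcdGaugeMeasure sch k)) /
      ∫ U, fermiIntegral (fermiBoltzmann U fun fl => sch.mq fl k) ∂(qcdGaugeMeasure sch k) =
    ∑ B : Finset (Fin n),
      ((∏ i ∈ Bᶜ, (((z₂ (σ i) k * sch.a k ^ 4 * (sch.shift (σ i) k - shift₂ (σ i) k) : ℝ) : ℂ) *
          ∑ x ∈ box 4 (sch.L k), ((f i (sch.a k • siteToE x) : ℝ) : ℂ))) *
        ∏ i ∈ B, ((z₂ (σ i) k / sch.z (σ i) k : ℝ) : ℂ)) *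
      qcdLatticeSchwinger sch k B.card (fun j => σ (B.orderEmbOfFin rfl j))
        (fun j => f (B.orderEmbOfFin rfl j)) := by
  have hpt : ∀ U : GaugeConfig 4 (sch.side k) (Matrix.specialUnitaryGroup (Fin 3) ℂ),
      fermiIntegral ((List.ofFn fun i => ∑ x ∈ box 4 (sch.L k),
        ((z₂ (σ i) k * sch.a k ^ 4 * f i (sch.a k • siteToE x) : ℝ) : ℂ) •
          (insertion U (σ i) x - algebraMap ℂ _ ((shift₂ (σ i) k : ℝ) : ℂ))).prod *
        fermiBoltzmann U fun fl => sch.mq fl k) =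
      ∑ B : Finset (Fin n),
        ((∏ i ∈ Bᶜ, (((z₂ (σ i) k * sch.a k ^ 4 * (sch.shift (σ i) k - shift₂ (σ i) k) : ℝ) : ℂ) *
            ∑ x ∈ box 4 (sch.L k), ((f i (sch.a k • siteToE x) : ℝ) : ℂ))) *
          ∏ i ∈ B, ((z₂ (σ i) k / sch.z (σ i) k : ℝ) : ℂ)) *
        fermiIntegral ((List.ofFn fun j : Fin B.card =>
          smearedInsertion sch k U (σ (B.orderEmbOfFin rfl j)) (f (B.orderEmbOfFin rfl j))).prod *
            fermiBoltzmann U fun fl => sch.mq fl k) := by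
    intro U
    rw [prod_smeared_transfer sch k z₂ shift₂ σ hz f U, Finset.sum_mul, map_sum]
    exact Finset.sum_congr rfl fun B _ => by rw [smul_mul_assoc, map_smul, smul_eq_mul]
  simp_rw [hpt]
  rw [integral_finsetSum _ fun B _ =>
    (integrable_fermiIntegral_prod_smearedInsertion sch k _ _).const_mul _]
  simp only [integral_const_mul]
  rw [Finset.sum_div]
  refine Finset.sum_congr rfl fun B _ => ?_
  rw [mul_div_assoc]
  rfl

/-- **Reading a sister scheme over the reference scheme.**  `reg.scheme m z₂ shift₂` and
`reg.scheme m z₁ shift₁` have the same torus, coupling, bare masses and gauge measure, so the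
`n`-point function of the former IS the honest expectation, over the latter, of the ordered product of
the fields with renormalisations `(z₂, shift₂)` (definitional). [folklore] -/
theorem schwinger_scheme_read (reg : QCDRegularisation Nf) (m : Fin Nf → ℝ)
    (z₁ shift₁ z₂ shift₂ : QCDField Nf → ℕ → ℝ) (k n : ℕ) (σ : Fin n → QCDField Nf)
    (f : Fin n → 𝓢(EuclideanSpace ℝ (Fin 4), ℝ)) :
    qcdLatticeSchwinger (reg.scheme m z₂ shift₂) k n σ f =
      (∫ U, fermiIntegral ((List.ofFn fun i => ∑ x ∈ box 4 ((reg.scheme m z₁ shift₁).L k),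
        ((z₂ (σ i) k * (reg.scheme m z₁ shift₁).a k ^ 4 *
            f i ((reg.scheme m z₁ shift₁).a k • siteToE x) : ℝ) : ℂ) •
          (insertion U (σ i) x - algebraMap ℂ _ ((shift₂ (σ i) k : ℝ) : ℂ))).prod *
        fermiBoltzmann U fun fl => (reg.scheme m z₁ shift₁).mq fl k)
          ∂(qcdGaugeMeasure (reg.scheme m z₁ shift₁) k)) /
      ∫ U, fermiIntegral (fermiBoltzmann U fun fl => (reg.scheme m z₁ shift₁).mq fl k)
        ∂(qcdGaugeMeasure (reg.scheme m z₁ shift₁) k) :=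
  rfl

/-- **THE RAW SCHEME-TRANSFER IDENTITY.**  For two schemes over the same `(reg, m, k)` with
`z₁(σᵢ, k) ≠ 0`:
`S_{z₂,shift₂}(σ, f) = Σ_{B ⊆ Fin n} (∏_{i ∉ B} z₂ a_k⁴ (shift₁ − shift₂)(σᵢ,k) Σ_x fᵢ(a_k x)) ·
(∏_{i ∈ B} z₂/z₁ (σᵢ,k)) · S_{z₁,shift₁}(σ ∘ e_B, f ∘ e_B)`,
`e_B = B.orderEmbOfFin rfl`. [cite: MontvayMunster1994, §5.1] -/
theorem qcdLatticeSchwinger_transfer (reg : QCDRegularisation Nf) (m : Fin Nf → ℝ)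
    (z₁ shift₁ z₂ shift₂ : QCDField Nf → ℕ → ℝ) (k : ℕ) {n : ℕ} (σ : Fin n → QCDField Nf)
    (hz : ∀ i, z₁ (σ i) k ≠ 0) (f : Fin n → 𝓢(EuclideanSpace ℝ (Fin 4), ℝ)) :
    qcdLatticeSchwinger (reg.scheme m z₂ shift₂) k n σ f =
      ∑ B : Finset (Fin n),
        ((∏ i ∈ Bᶜ, (((z₂ (σ i) k * reg.a k ^ 4 * (shift₁ (σ i) k - shift₂ (σ i) k) : ℝ) : ℂ) *
            ∑ x ∈ box 4 (reg.L k), ((f i (reg.a k • siteToE x) : ℝ) : ℂ))) *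
          ∏ i ∈ B, ((z₂ (σ i) k / z₁ (σ i) k : ℝ) : ℂ)) *
        qcdLatticeSchwinger (reg.scheme m z₁ shift₁) k B.card (fun j => σ (B.orderEmbOfFin rfl j))
          (fun j => f (B.orderEmbOfFin rfl j)) := by
  rw [schwinger_scheme_read reg m z₁ shift₁ z₂ shift₂ k n σ f]
  exact schwinger_transfer_raw (reg.scheme m z₁ shift₁) k z₂ shift₂ σ hz f

/-! ### Zero-point idempotence, arity transport, one-point transfer -/

/-- Multiplying an `n`-point function by the zero-point function `Z/Z` changes nothing (`Z/Z = 1`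
unless the fermionic-gauge partition function `Z` vanishes, when every function is the junk `0`). [folklore] -/
theorem qcdLatticeSchwinger_mul_zeroPoint (sch : QCDScheme Nf) (k n : ℕ) (σ : Fin n → QCDField Nf)
    (f : Fin n → 𝓢(EuclideanSpace ℝ (Fin 4), ℝ)) (σ₀ : Fin 0 → QCDField Nf)
    (f₀ : Fin 0 → 𝓢(EuclideanSpace ℝ (Fin 4), ℝ)) :
    qcdLatticeSchwinger sch k n σ f * qcdLatticeSchwinger sch k 0 σ₀ f₀ = qcdLatticeSchwinger sch k n σ f := by
  unfold qcdLatticeSchwinger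
  simp only [List.ofFn_zero, List.prod_nil, one_mul]
  rcases eq_or_ne (∫ U, fermiIntegral (fermiBoltzmann U fun fl => sch.mq fl k) ∂(qcdGaugeMeasure sch k)) 0
    with h | h
  · rw [h, div_zero, div_zero, zero_mul]
  · rw [div_self h, mul_one]

/-- Powers of the zero-point function are absorbed likewise. [folklore] -/
theorem qcdLatticeSchwinger_mul_zeroPoint_pow (sch : QCDScheme Nf) (k n : ℕ) (σ : Fin n → QCDField Nf)
    (f : Fin n → 𝓢(EuclideanSpace ℝ (Fin 4), ℝ)) (σ₀ : Fin 0 → QCDField Nf)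
    (f₀ : Fin 0 → 𝓢(EuclideanSpace ℝ (Fin 4), ℝ)) (j : ℕ) :
    qcdLatticeSchwinger sch k n σ f * qcdLatticeSchwinger sch k 0 σ₀ f₀ ^ j =
      qcdLatticeSchwinger sch k n σ f := by
  induction j with
  | zero => rw [pow_zero, mul_one]
  | succ j ih => rw [pow_succ, ← mul_assoc, ih, qcdLatticeSchwinger_mul_zeroPoint]

/-- Arity transport of the restricted functions along `B.card = n'`. [folklore] -/
theorem schwinger_arity_congr (sch : QCDScheme Nf) (k : ℕ) {n : ℕ} (σ : Fin n → QCDField Nf)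
    (f : Fin n → 𝓢(EuclideanSpace ℝ (Fin 4), ℝ)) (B : Finset (Fin n)) {n' : ℕ} (h : B.card = n') :
    qcdLatticeSchwinger sch k B.card (fun j => σ (B.orderEmbOfFin rfl j))
        (fun j => f (B.orderEmbOfFin rfl j)) =
      qcdLatticeSchwinger sch k n' (fun j => σ (B.orderEmbOfFin h j)) (fun j => f (B.orderEmbOfFin h j)) := by
  subst h
  rfl

/-- **One-point transfer over a scheme (raw)**: `⟨Φ₂^s(g)⟩ = (z₂/z)⟨Φ^s(g)⟩ + c_s(g) · (Z/Z)`. [folklore] -/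
theorem onePoint_transfer_raw (sch : QCDScheme Nf) (k : ℕ) (z₂ shift₂ : QCDField Nf → ℕ → ℝ)
    (s : QCDField Nf) (hz : sch.z s k ≠ 0) (g : 𝓢(EuclideanSpace ℝ (Fin 4), ℝ)) :
    (∫ U, fermiIntegral ((List.ofFn fun _ : Fin 1 => ∑ x ∈ box 4 (sch.L k),
        ((z₂ s k * sch.a k ^ 4 * g (sch.a k • siteToE x) : ℝ) : ℂ) •
          (insertion U s x - algebraMap ℂ _ ((shift₂ s k : ℝ) : ℂ))).prod *
        fermiBoltzmann U fun fl => sch.mq fl k) ∂(qcdGaugeMeasure sch k)) /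
      ∫ U, fermiIntegral (fermiBoltzmann U fun fl => sch.mq fl k) ∂(qcdGaugeMeasure sch k) =
    ((z₂ s k / sch.z s k : ℝ) : ℂ) * sch.onePoint k s g +
      (((z₂ s k * sch.a k ^ 4 * (sch.shift s k - shift₂ s k) : ℝ) : ℂ) *
          ∑ x ∈ box 4 (sch.L k), ((g (sch.a k • siteToE x) : ℝ) : ℂ)) *
        qcdLatticeSchwinger sch k 0 ![] ![] := by
  have key₁ : ∀ {c : ℕ}, c = 1 →
      qcdLatticeSchwinger sch k c (fun _ => s) (fun _ => g) = sch.onePoint k s g := by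
    rintro c rfl
    rfl
  have key₀ : ∀ {c : ℕ}, c = 0 →
      qcdLatticeSchwinger sch k c (fun _ => s) (fun _ => g) = qcdLatticeSchwinger sch k 0 ![] ![] := by
    rintro c rfl
    exact congrArg₂ (qcdLatticeSchwinger sch k 0) (funext fun j => Fin.elim0 j) (funext fun j => Fin.elim0 j)
  rw [schwinger_transfer_raw sch k z₂ shift₂ (fun _ : Fin 1 => s) (fun _ => hz) (fun _ => g),
    sum_finset_fin_one, add_comm]
  congr 1
  · rw [Finset.compl_univ, Finset.prod_empty, one_mul, Fin.prod_univ_one,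
      key₁ (Finset.card_univ.trans (Fintype.card_fin 1))]
  · rw [Finset.compl_empty, Finset.prod_empty, mul_one, Fin.prod_univ_one, key₀ Finset.card_empty]

/-- **One-point transfer**: for two schemes over the same `(reg, m, k)` with `z₁(s,k) ≠ 0`,
`⟨Φ₂^s(g)⟩ = (z₂/z₁)(s,k) ⟨Φ₁^s(g)⟩ + z₂ a_k⁴ (shift₁ − shift₂)(s,k) (Σ_x g(a_k x)) · (Z/Z)`. [cite: MontvayMunster1994, §5.1] -/
theorem onePoint_transfer (reg : QCDRegularisation Nf) (m : Fin Nf → ℝ)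
    (z₁ shift₁ z₂ shift₂ : QCDField Nf → ℕ → ℝ) (k : ℕ) (s : QCDField Nf) (hz : z₁ s k ≠ 0)
    (g : 𝓢(EuclideanSpace ℝ (Fin 4), ℝ)) :
    (reg.scheme m z₂ shift₂).onePoint k s g =
      ((z₂ s k / z₁ s k : ℝ) : ℂ) * (reg.scheme m z₁ shift₁).onePoint k s g +
        (((z₂ s k * reg.a k ^ 4 * (shift₁ s k - shift₂ s k) : ℝ) : ℂ) *
            ∑ x ∈ box 4 (reg.L k), ((g (reg.a k • siteToE x) : ℝ) : ℂ)) *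
          qcdLatticeSchwinger (reg.scheme m z₁ shift₁) k 0 ![] ![] := by
  rw [QCDScheme.onePoint_eq, schwinger_scheme_read reg m z₁ shift₁ z₂ shift₂ k 1]
  exact onePoint_transfer_raw (reg.scheme m z₁ shift₁) k z₂ shift₂ s hz g

/-! ### Truncation by one-point functions: the transfer identity for one-point subtracted targets -/

/-- **THE TRANSFER IDENTITY FOR A ONE-POINT SUBTRACTED TARGET** (truncation by one-point functions).
If every target one-point function on the string vanishes, `⟨Φ₂^{σᵢ}(fᵢ)⟩ = 0`, then
`S₂(σ, f) = (∏ᵢ (z₂/z₁)(σᵢ,k)) · Σ_B (−1)^{|Bᶜ|} (∏_{i ∉ B} ⟨Φ₁^{σᵢ}(fᵢ)⟩) · S₁(σ ∘ e_B, f ∘ e_B)`: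
inside every correlation function the target field is exactly `λ_s (Φ₁^s − ⟨Φ₁^s⟩)`. [cite: GlimmJaffe1987, §6.1] [cite: MontvayMunster1994, §5.1] -/
theorem qcdLatticeSchwinger_transfer_of_onePoint_eq_zero (reg : QCDRegularisation Nf) (m : Fin Nf → ℝ)
    (z₁ shift₁ z₂ shift₂ : QCDField Nf → ℕ → ℝ) (k : ℕ) {n : ℕ} (σ : Fin n → QCDField Nf)
    (hz : ∀ i, z₁ (σ i) k ≠ 0) (f : Fin n → 𝓢(EuclideanSpace ℝ (Fin 4), ℝ))
    (h₁ : ∀ i, (reg.scheme m z₂ shift₂).onePoint k (σ i) (f i) = 0) :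
    qcdLatticeSchwinger (reg.scheme m z₂ shift₂) k n σ f =
      (∏ i, ((z₂ (σ i) k / z₁ (σ i) k : ℝ) : ℂ)) *
        ∑ B : Finset (Fin n), (-1) ^ Bᶜ.card *
          (∏ i ∈ Bᶜ, (reg.scheme m z₁ shift₁).onePoint k (σ i) (f i)) *
          qcdLatticeSchwinger (reg.scheme m z₁ shift₁) k B.card (fun j => σ (B.orderEmbOfFin rfl j))
            (fun j => f (B.orderEmbOfFin rfl j)) := by
  classical
  rw [qcdLatticeSchwinger_transfer reg m z₁ shift₁ z₂ shift₂ k σ hz f, Finset.mul_sum]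
  refine Finset.sum_congr rfl fun B _ => ?_
  set q : ℂ := qcdLatticeSchwinger (reg.scheme m z₁ shift₁) k 0 ![] ![] with hq
  set S : ℂ := qcdLatticeSchwinger (reg.scheme m z₁ shift₁) k B.card (fun j => σ (B.orderEmbOfFin rfl j))
    (fun j => f (B.orderEmbOfFin rfl j)) with hS
  have hSq : S * q ^ Bᶜ.card = S := qcdLatticeSchwinger_mul_zeroPoint_pow _ k _ _ _ _ _ _
  -- the constants against `Z/Z` are minus the rescaled reference one-point functions
  have hc : ∀ i, (((z₂ (σ i) k * reg.a k ^ 4 * (shift₁ (σ i) k - shift₂ (σ i) k) : ℝ) : ℂ) *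
      ∑ x ∈ box 4 (reg.L k), ((f i (reg.a k • siteToE x) : ℝ) : ℂ)) * q =
      -(((z₂ (σ i) k / z₁ (σ i) k : ℝ) : ℂ) * (reg.scheme m z₁ shift₁).onePoint k (σ i) (f i)) := by
    intro i
    have h := onePoint_transfer reg m z₁ shift₁ z₂ shift₂ k (σ i) (hz i) (f i)
    rw [h₁ i] at h
    linear_combination -h
  calc (∏ i ∈ Bᶜ, (((z₂ (σ i) k * reg.a k ^ 4 * (shift₁ (σ i) k - shift₂ (σ i) k) : ℝ) : ℂ) *
          ∑ x ∈ box 4 (reg.L k), ((f i (reg.a k • siteToE x) : ℝ) : ℂ))) *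
        (∏ i ∈ B, ((z₂ (σ i) k / z₁ (σ i) k : ℝ) : ℂ)) * S
      = (∏ i ∈ Bᶜ, (((z₂ (σ i) k * reg.a k ^ 4 * (shift₁ (σ i) k - shift₂ (σ i) k) : ℝ) : ℂ) *
          ∑ x ∈ box 4 (reg.L k), ((f i (reg.a k • siteToE x) : ℝ) : ℂ))) * q ^ Bᶜ.card *
        (∏ i ∈ B, ((z₂ (σ i) k / z₁ (σ i) k : ℝ) : ℂ)) * S := by
          conv_lhs => rw [← hSq]
          ring
    _ = (∏ i ∈ Bᶜ, -(((z₂ (σ i) k / z₁ (σ i) k : ℝ) : ℂ) * (reg.scheme m z₁ shift₁).onePoint k (σ i) (f i))) *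
        (∏ i ∈ B, ((z₂ (σ i) k / z₁ (σ i) k : ℝ) : ℂ)) * S := by
          rw [← Finset.prod_const, ← Finset.prod_mul_distrib]
          simp_rw [hc]
    _ = (-1) ^ Bᶜ.card * ((∏ i ∈ Bᶜ, ((z₂ (σ i) k / z₁ (σ i) k : ℝ) : ℂ)) *
          ∏ i ∈ B, ((z₂ (σ i) k / z₁ (σ i) k : ℝ) : ℂ)) *
        (∏ i ∈ Bᶜ, (reg.scheme m z₁ shift₁).onePoint k (σ i) (f i)) * S := by
          rw [Finset.prod_neg, Finset.prod_mul_distrib]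
          ring
    _ = ((∏ i, ((z₂ (σ i) k / z₁ (σ i) k : ℝ) : ℂ))) * ((-1) ^ Bᶜ.card *
        (∏ i ∈ Bᶜ, (reg.scheme m z₁ shift₁).onePoint k (σ i) (f i)) * S) := by
          rw [Finset.prod_compl_mul_prod]
          ring

/-- **The calibrated `n`-point functions over any reference scheme** (with non-vanishing `z₁` on the
string): a `CalibratedSpeciesFamily` is one-point subtracted, so its `n`-point functions at `m` are
`(∏ᵢ 𝒞.z/z₁) · Σ_B (−1)^{|Bᶜ|} (∏_{i ∉ B} ⟨Φ₁^{σᵢ}(fᵢ)⟩) · S₁(σ ∘ e_B, f ∘ e_B)` — the calibrated field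
is `λ_s (Φ₁^s − ⟨Φ₁^s⟩)`, `λ_s = 𝒞.z(m,s,k)/z₁(s,k)`. [cite: MontvayMunster1994, §1.7 (1.251)–(1.253) and §5.1] -/
theorem calibrated_transfer {reg : QCDRegularisation Nf} (𝒞 : CalibratedSpeciesFamily reg)
    (m : Fin Nf → ℝ) (z₁ shift₁ : QCDField Nf → ℕ → ℝ) (k : ℕ) {n : ℕ} (σ : Fin n → QCDField Nf)
    (hz : ∀ i, z₁ (σ i) k ≠ 0) (f : Fin n → 𝓢(EuclideanSpace ℝ (Fin 4), ℝ)) :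
    qcdLatticeSchwinger (𝒞.scheme m) k n σ f =
      (∏ i, ((𝒞.z m (σ i) k / z₁ (σ i) k : ℝ) : ℂ)) *
        ∑ B : Finset (Fin n), (-1) ^ Bᶜ.card *
          (∏ i ∈ Bᶜ, (reg.scheme m z₁ shift₁).onePoint k (σ i) (f i)) *
          qcdLatticeSchwinger (reg.scheme m z₁ shift₁) k B.card (fun j => σ (B.orderEmbOfFin rfl j))
            (fun j => f (B.orderEmbOfFin rfl j)) :=
  qcdLatticeSchwinger_transfer_of_onePoint_eq_zero reg m z₁ shift₁ (𝒞.z m) (𝒞.shift m) k σ hz f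
    fun i => 𝒞.onePoint_eq_zero m (σ i) k (f i)

/-- **CONVERGENCE TRANSFER.**  If along `k → ∞` the ratios `𝒞.z(m,σᵢ,k)/z₁(σᵢ,k)` converge, and
the reference one-point functions of the string and the reference functions of every sub-string
`(σ, f) ∘ e_B` converge, then the calibrated `n`-point function of `(σ, f)` at `m` converges (to the
transferred combination of the limits). [folklore] -/
theorem tendsto_calibrated_of_tendsto {reg : QCDRegularisation Nf} (𝒞 : CalibratedSpeciesFamily reg)
    (m : Fin Nf → ℝ) (z₁ shift₁ : QCDField Nf → ℕ → ℝ) {n : ℕ} (σ : Fin n → QCDField Nf)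
    (hz : ∀ i k, z₁ (σ i) k ≠ 0) (f : Fin n → 𝓢(EuclideanSpace ℝ (Fin 4), ℝ))
    (Λ : Fin n → ℂ)
    (hΛ : ∀ i, Tendsto (fun k : ℕ => ((𝒞.z m (σ i) k / z₁ (σ i) k : ℝ) : ℂ)) atTop (nhds (Λ i)))
    (o : Fin n → ℂ)
    (ho : ∀ i, Tendsto (fun k : ℕ => (reg.scheme m z₁ shift₁).onePoint k (σ i) (f i)) atTop (nhds (o i)))
    (S : Finset (Fin n) → ℂ)
    (hS : ∀ B : Finset (Fin n), Tendsto (fun k : ℕ =>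
      qcdLatticeSchwinger (reg.scheme m z₁ shift₁) k B.card (fun j => σ (B.orderEmbOfFin rfl j))
        (fun j => f (B.orderEmbOfFin rfl j))) atTop (nhds (S B))) :
    Tendsto (fun k : ℕ => qcdLatticeSchwinger (𝒞.scheme m) k n σ f) atTop
      (nhds ((∏ i, Λ i) * ∑ B : Finset (Fin n), (-1) ^ Bᶜ.card * (∏ i ∈ Bᶜ, o i) * S B)) := by
  have he : (fun k : ℕ => qcdLatticeSchwinger (𝒞.scheme m) k n σ f) = fun k =>
      (∏ i, ((𝒞.z m (σ i) k / z₁ (σ i) k : ℝ) : ℂ)) *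
        ∑ B : Finset (Fin n), (-1) ^ Bᶜ.card *
          (∏ i ∈ Bᶜ, (reg.scheme m z₁ shift₁).onePoint k (σ i) (f i)) *
          qcdLatticeSchwinger (reg.scheme m z₁ shift₁) k B.card (fun j => σ (B.orderEmbOfFin rfl j))
            (fun j => f (B.orderEmbOfFin rfl j)) :=
    funext fun k => calibrated_transfer 𝒞 m z₁ shift₁ k σ (fun i => hz i k) f
  rw [he]
  refine (tendsto_finsetProd _ fun i _ => hΛ i).mul (tendsto_finsetSum _ fun B _ => ?_)
  exact (tendsto_const_nhds.mul (tendsto_finsetProd _ fun i _ => ho i)).mul (hS B)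

end Summit.QuantumFields.QCD.Cruxes.RetypedContinuumComplement.VitaliMassDescent

end
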